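import Summits.Ventures.CertifiedManyBodySolver.Downfold.EmeryBoxesLa214UppExact
import Literature.MathematicalPhysics.QuantumLattice.EmeryThreeBandStatesNonempty
import HarnessLib

/-!
# The cluster-floor seam WITHOUT the class hypothesis: four `CuO₄`-plus certificates ⇒ the typed three-band floor word, nothing else assumed
# (hubbard-box-p1's `emeryStates_nonempty`); La₂CuO₄ at its filling of record `ρ = 5/4`

Venture CertifiedManyBodySolver, cell `pub/hubbard-downfold` (S1 = ROUTER), seat hubbard-downfold-mod-4 (S1/S2 Emery seam); namespace
`Summit.Ventures.CertifiedManyBodySolver.Downfold`. Every door of `Downfold/EmeryClusterFloorSeam` (p621945 / p622201 / p623247) and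
`Downfold/EmeryBoxesLa214UppExact` (p623845) carried `(emeryStates ρ).Nonempty` as a hypothesis. hubbard-box-p1 g15's
`EmeryThreeBandStatesNonempty` (p624087, 2026-08-28T10:13Z) proves `InfVolFermionState.emeryStates_nonempty : 0 ≤ ρ → ρ ≤ 3/2 → (emeryStates ρ).Nonempty`
(witness: the periodic product of an explicit even diagonal cell density matrix, dummy empty) and the converse. This file restates the TURNKEY doors with
that hypothesis discharged — the END STATE of the S1 → S2 order form for three-band FLOOR words:

* **`holdsOn_emeryEnergyFloor_of_cuO4Certificates_free`** — ANY typed Emery box with entries `t_pd, t_pp, Delta_pd, U_dd, U_pp`, any cell filling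
  `ρ ∈ [0, 3/2]`, any sign pattern: four uniform-weight certificates on the 1024-dimensional plus window `emeryCuO4Window`, each at its own μ-tilt, ⇒
  `HoldsOn (m ≤ emeryEnergyDensity (emeryLine s (emeryLineCoords εp p)) ρ) E` for every `m ≤ min_i (q₀ i/(4M) − μ i·ρ)`. Hypotheses left: the four
  `PosSemidef` facts (the device's output), `0 < M`, `0 ≤ ρ ≤ 3/2`.
* `holdsOn_emeryEnergyFloor_of_tiltedCornerCertificates_free` — the same on a general window `B` with its covering hypothesis `hfit` (e.g. box-p1's
  `emeryRingWindow_fit`, or any superset of the plus by `periodicFit_mono`).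
* La₂CuO₄ #18 at `ρ = 5/4` (x = 0; `emeryBoxLa214v122_cellFilling`): **`emeryBoxLa214v122_energyFloor54_of_cuO4Certificates_exact`** (ROBUST corners
  `la214v122xCorner`, `U_p = 3.39`; binds the current companion and, via `emeryBoxLa214v122x_energyFloor54_of_cuO4Certificates`, the re-printed one) and
  `emeryBoxLa214v122_energyFloor54_of_cuO4Certificates` (as-printed corners `la214v122Corner`).

Everything PROVED (0 sorry); no definition. HONEST SCOPE: doors — no certificate, no number; SCREENING-GRADE box ends; the `CuO₄` Anderson floor is crude by
construction; words of record unchanged.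
-/

noncomputable section

namespace Summit.Ventures.CertifiedManyBodySolver.Downfold

open NonemptyInterval Matrix Finset Literature.Probability.LatticeModels
open Literature.MathematicalPhysics.QuantumLattice Literature.Computation.Certificates
open scoped BigOperators ComplexOrder

/-! ### Generic typed box: the class hypothesis discharged -/

/-- **Four tilted certificates on a fitting window ⇒ the typed 3BE floor word, for every `ρ ∈ [0, 3/2]`** (no class hypothesis).
[cite: Anderson1951, eq. (2)] [cite: Israel1979, Thm. I.3.4] -/
theorem holdsOn_emeryEnergyFloor_of_tiltedCornerCertificates_free {E : EmeryBox} {eA eB eD eUd eUp : Entry} {εp : ℚ}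
    (hA : E .tpd = some eA) (hB : E .tpp = some eB) (hD : E .DeltaPd = some eD)
    (hUd : E .Udd = some eUd) (hUp : E .Upp = some eUp) (s : Fin 4 → ℝ) {ρ : ℝ} (hρ0 : 0 ≤ ρ) (hρ1 : ρ ≤ 3 / 2)
    (B : Finset (Site 2)) {M : ℝ} (hM : 0 < M)
    (hfit : ∀ (θ : Fin 14 → ℝ) (c : Cell liebPeriods) (X : Finset (Site 2)), cellPos c ∈ X → (emeryInteraction θ).Φ X ≠ 0 →
      ∃ v : Site 2, InCoset liebPeriods 0 v ∧ shiftSet v X ⊆ B)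
    (G : Fin 4 → FermionOp B) (hG0 : ∀ i, ∀ ω' : InfVolFermionState 2, ω'.IsPeriodic liebPeriods → (ω'.expect B (G i)).re = 0)
    (μ q₀ : Fin 4 → ℝ)
    (hq : ∀ i : Fin 4, ((⟨fun X => (uniformPeriodicWeight liebPeriods B M X : ℂ) •
        (emeryInteraction (emeryLine s (lowerCorner (emeryLo εp eA eB eD eUd eUp) (emeryHi εp eA eB eD eUd eUp) i) +
          μ i • levelDir)).Φ X⟩ : FermionInteraction 2).localHamiltonian B + G i - (q₀ i : ℂ) • (1 : FermionOp B)).PosSemidef)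
    {m : ℝ} (hm : ∀ i : Fin 4, m ≤ q₀ i / (4 * M) - μ i * ρ) :
    HoldsOn (fun p : EmeryCoord → ℝ => m ≤ emeryEnergyDensity (emeryLine s (emeryLineCoords (εp : ℝ) p)) ρ) E :=
  holdsOn_emeryEnergyFloor_of_tiltedCornerCertificates hA hB hD hUd hUp s (InfVolFermionState.emeryStates_nonempty hρ0 hρ1) B hM hfit G hG0 μ q₀ hq hm

/-- **THE END STATE OF THE ORDER FORM: four tilted `CuO₄`-plus certificates ⇒ the typed 3BE floor word, for every `ρ ∈ [0, 3/2]`** — nothing assumed but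
the certificates. [cite: Anderson1951, eq. (2)] [cite: Israel1979, Thm. I.3.4] -/
theorem holdsOn_emeryEnergyFloor_of_cuO4Certificates_free {E : EmeryBox} {eA eB eD eUd eUp : Entry} {εp : ℚ}
    (hA : E .tpd = some eA) (hB : E .tpp = some eB) (hD : E .DeltaPd = some eD)
    (hUd : E .Udd = some eUd) (hUp : E .Upp = some eUp) (s : Fin 4 → ℝ) {ρ : ℝ} (hρ0 : 0 ≤ ρ) (hρ1 : ρ ≤ 3 / 2) {M : ℝ} (hM : 0 < M)
    (G : Fin 4 → FermionOp emeryCuO4Window)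
    (hG0 : ∀ i, ∀ ω' : InfVolFermionState 2, ω'.IsPeriodic liebPeriods → (ω'.expect emeryCuO4Window (G i)).re = 0)
    (μ q₀ : Fin 4 → ℝ)
    (hq : ∀ i : Fin 4, ((⟨fun X => (uniformPeriodicWeight liebPeriods emeryCuO4Window M X : ℂ) •
        (emeryInteraction (emeryLine s (lowerCorner (emeryLo εp eA eB eD eUd eUp) (emeryHi εp eA eB eD eUd eUp) i) +
          μ i • levelDir)).Φ X⟩ : FermionInteraction 2).localHamiltonian emeryCuO4Window + G i -
        (q₀ i : ℂ) • (1 : FermionOp emeryCuO4Window)).PosSemidef)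
    {m : ℝ} (hm : ∀ i : Fin 4, m ≤ q₀ i / (4 * M) - μ i * ρ) :
    HoldsOn (fun p : EmeryCoord → ℝ => m ≤ emeryEnergyDensity (emeryLine s (emeryLineCoords (εp : ℝ) p)) ρ) E :=
  holdsOn_emeryEnergyFloor_of_cuO4Certificates hA hB hD hUd hUp s (InfVolFermionState.emeryStates_nonempty hρ0 hρ1) hM G hG0 μ q₀ hq hm

/-! ### La₂CuO₄ (#18) at its filling of record `ρ = 5/4` -/

/-- **La₂CuO₄, as-printed corners, ρ = 5/4: four tilted plus-certificates at `emeryLine s (la214v122Corner i) + μ i·levelDir` ⇒ the floor word on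
`emeryBoxLa214v122`** — nothing assumed but the certificates. [cite: Anderson1951, eq. (2)] [cite: Israel1979, Thm. I.3.4] -/
theorem emeryBoxLa214v122_energyFloor54_of_cuO4Certificates (s : Fin 4 → ℝ) {M : ℝ} (hM : 0 < M)
    (G : Fin 4 → FermionOp emeryCuO4Window)
    (hG0 : ∀ i, ∀ ω' : InfVolFermionState 2, ω'.IsPeriodic liebPeriods → (ω'.expect emeryCuO4Window (G i)).re = 0)
    (μ q₀ : Fin 4 → ℝ)
    (hq : ∀ i : Fin 4, ((⟨fun X => (uniformPeriodicWeight liebPeriods emeryCuO4Window M X : ℂ) •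
        (emeryInteraction (emeryLine s (la214v122Corner i) + μ i • levelDir)).Φ X⟩ : FermionInteraction 2).localHamiltonian emeryCuO4Window +
        G i - (q₀ i : ℂ) • (1 : FermionOp emeryCuO4Window)).PosSemidef)
    {m : ℝ} (hm : ∀ i : Fin 4, m ≤ q₀ i / (4 * M) - μ i * (5 / 4)) :
    HoldsOn (fun p : EmeryCoord → ℝ => m ≤ emeryEnergyDensity (emeryLine s (emeryLineCoords 0 p)) (5 / 4)) emeryBoxLa214v122 :=
  emeryBoxLa214v122_energyFloor_of_cuO4Certificates s (InfVolFermionState.emeryStates_nonempty (by norm_num) (by norm_num)) hM G hG0 μ q₀ hq hm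

/-- **La₂CuO₄, ROBUST corners (`U_p = 3.39`), ρ = 5/4, on the exact companion `emeryBoxLa214v122x`** — nothing assumed but the certificates.
[cite: Anderson1951, eq. (2)] [cite: Israel1979, Thm. I.3.4] -/
theorem emeryBoxLa214v122x_energyFloor54_of_cuO4Certificates (s : Fin 4 → ℝ) {M : ℝ} (hM : 0 < M)
    (G : Fin 4 → FermionOp emeryCuO4Window)
    (hG0 : ∀ i, ∀ ω' : InfVolFermionState 2, ω'.IsPeriodic liebPeriods → (ω'.expect emeryCuO4Window (G i)).re = 0)
    (μ q₀ : Fin 4 → ℝ)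
    (hq : ∀ i : Fin 4, ((⟨fun X => (uniformPeriodicWeight liebPeriods emeryCuO4Window M X : ℂ) •
        (emeryInteraction (emeryLine s (la214v122xCorner i) + μ i • levelDir)).Φ X⟩ : FermionInteraction 2).localHamiltonian emeryCuO4Window +
        G i - (q₀ i : ℂ) • (1 : FermionOp emeryCuO4Window)).PosSemidef)
    {m : ℝ} (hm : ∀ i : Fin 4, m ≤ q₀ i / (4 * M) - μ i * (5 / 4)) :
    HoldsOn (fun p : EmeryCoord → ℝ => m ≤ emeryEnergyDensity (emeryLine s (emeryLineCoords 0 p)) (5 / 4)) emeryBoxLa214v122x :=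
  emeryBoxLa214v122x_energyFloor_of_cuO4Certificates s (InfVolFermionState.emeryStates_nonempty (by norm_num) (by norm_num)) hM G hG0 μ q₀ hq hm

/-- **THE La₂CuO₄ ORDER, FINAL FORM: four tilted `CuO₄`-plus certificates at the ROBUST corners `la214v122xCorner` (U_p = 3.39), ρ = 5/4, give the
three-band floor word on the companion of record `emeryBoxLa214v122`** — and nothing else is assumed. (By `emeryBoxLa214v122x_energyFloor54_of_cuO4Certificates`
the same certificates bind the re-printed row of ruling R-mt (c2).) [cite: Anderson1951, eq. (2)] [cite: Israel1979, Thm. I.3.4] -/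
theorem emeryBoxLa214v122_energyFloor54_of_cuO4Certificates_exact (s : Fin 4 → ℝ) {M : ℝ} (hM : 0 < M)
    (G : Fin 4 → FermionOp emeryCuO4Window)
    (hG0 : ∀ i, ∀ ω' : InfVolFermionState 2, ω'.IsPeriodic liebPeriods → (ω'.expect emeryCuO4Window (G i)).re = 0)
    (μ q₀ : Fin 4 → ℝ)
    (hq : ∀ i : Fin 4, ((⟨fun X => (uniformPeriodicWeight liebPeriods emeryCuO4Window M X : ℂ) •
        (emeryInteraction (emeryLine s (la214v122xCorner i) + μ i • levelDir)).Φ X⟩ : FermionInteraction 2).localHamiltonian emeryCuO4Window +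
        G i - (q₀ i : ℂ) • (1 : FermionOp emeryCuO4Window)).PosSemidef)
    {m : ℝ} (hm : ∀ i : Fin 4, m ≤ q₀ i / (4 * M) - μ i * (5 / 4)) :
    HoldsOn (fun p : EmeryCoord → ℝ => m ≤ emeryEnergyDensity (emeryLine s (emeryLineCoords 0 p)) (5 / 4)) emeryBoxLa214v122 :=
  holdsOn_emeryBoxLa214v122_of_v122x (emeryBoxLa214v122x_energyFloor54_of_cuO4Certificates s hM G hG0 μ q₀ hq hm)

end Summit.Ventures.CertifiedManyBodySolver.Downfold

end
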